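import Mathlib
import Summits.ValiantsHypothesis.ValiantsHypothesis.Theses.NumTame
import Summits.ValiantsHypothesis.ValiantsHypothesis.Theorems.NumTameLowDegreeZModBits
import Summits.ValiantsHypothesis.ValiantsHypothesis.Theorems.NumTameLowDegreeReduction
import HarnessLib

/-!
# Route NumTame — the REPAIRED `LowDegreeRegime` (support for stmt-ValiantsHypothesis-5391):
# the finite-place twin, GRH-free

Item stmt-5391 `LowDegreeRegime` is mis-typed as filed (refuter g42-8, route review 2026-08-15,
evidence `NumTameEvidence.lean`): `∃ (K : IntermediateField ℚ ℂ) …, Module.finrank ℚ K ≤ r n ∧ …` is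
witnessed by `K = ⊤` (all of `ℂ`, `finrank = 0` by Mathlib's junk value), so the hypothesis no
longer bounds the DEGREE of the constants — and the degree bound is exactly what makes the
finite-place simulation GRH-free. This file proves the INTENDED statement, i.e. the item with
`FiniteDimensional ℚ K ∧` inserted (the refuter's fix), under which stmt-5391 closes at once after the
planner's restatement:

`lowDegreeRegime_of_finiteDimensional`: **if `φ_n : {0,1}^n → ℕ`, `φ_n < 2^{t(n)}`, `t` p-bounded,
is computed on the cube by fan-in-two `ℂ`-circuits of p-bounded size whose constants and sum weights
are ALGEBRAIC INTEGERS in a number field `K_n ⊂ ℂ` with `[K_n:ℚ] ≤ r(n)`, `r` p-bounded, then the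
bits of `φ_n` have polynomial-size `B₂`-circuits.** Proof: Bertrand prime `2^{t(n)} < p ≤ 2^{t(n)+1}`;
`exists_zmod_circuit_of_integral_constants` (skeleton over `ℤ[constants]`, reduction mod `p`,
Hrubeš–Yehudayoff simulation of the `≤ r(n)`-dimensional `𝔽_p`-algebra) gives a `ZMod p` circuit of
size `poly(r(n))` with Boolean values `φ_n mod p = φ_n`; `cktSize_testBits_of_zmod` simulates it by
`B₂`-circuits; the sizes form a p-bounded function, hence are dominated by one polynomial. No
Chebotarev, no heights, no GRH: the residues of the constants are advice.

Honest framing: the GRH-free finite-place half of a conditional route (NumTame); `VP ≠ VNP` is NOT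
proved and nothing here is progress on it.

## References

* P. Bürgisser, *Cook's versus Valiant's hypothesis*, Theoret. Comput. Sci. 235 (2000), §4–§5
  (reduction modulo primes, (A3)). [cite: Burgisser2000TCS, §4–§5]
* P. Koiran, *Hilbert's Nullstellensatz is in the polynomial hierarchy*, J. Complexity 12 (1996)
  (the GRH-dependence this twin avoids). [cite: Koiran1996]
-/

set_option linter.dupNamespace false

noncomputable section

open MvPolynomial

namespace Summit.ValiantsHypothesis.ValiantsHypothesis.Theorems.NumTame

open Literature.Computability.AlgebraicComplexity Literature.Computability.Complexity ArithCircuit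

/-- The size budget of the finite-place simulation as a function of the circuit-size/degree budget
`r` and the bit budget `t`: `((5r³+6r²+2r)·3r + 3r + 1) · gateCost (t+1) (t+1)`. [folklore] -/
theorem isPBounded_lowDegreeSize {r t : ℕ → ℕ} (hr : IsPBounded r) (ht : IsPBounded t) :
    IsPBounded fun n => ((5 * r n ^ 3 + 6 * r n ^ 2 + 2 * r n) * (3 * r n) + 3 * r n + 1) *
      gateCost (t n + 1) ((t n + 1) * 1) := by
  have hgc : IsPBounded fun n => gateCost (t n + 1) ((t n + 1) * 1) := by
    refine IsPBounded.mono (t := fun n => 2 * ((t n + 1) * 1) + 65 * (t n + 1 + 2) ^ 3)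
      ?_ fun n => gateCost_le _ _
    have ht1 : IsPBounded fun n => t n + 1 := IsPBounded.add_holds ht (IsPBounded.const 1)
    exact IsPBounded.add_holds
      (IsPBounded.mul_holds (IsPBounded.const 2) (IsPBounded.mul_holds ht1 (IsPBounded.const 1)))
      (IsPBounded.mul_holds (IsPBounded.const 65)
        (IsPBounded.pow_holds (IsPBounded.add_holds ht1 (IsPBounded.const 2)) 3))
  refine IsPBounded.mul_holds ?_ hgc
  refine IsPBounded.add_holds (IsPBounded.add_holds (IsPBounded.mul_holds ?_
    (IsPBounded.mul_holds (IsPBounded.const 3) hr)) (IsPBounded.mul_holds (IsPBounded.const 3) hr))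
    (IsPBounded.const 1)
  exact IsPBounded.add_holds (IsPBounded.add_holds
    (IsPBounded.mul_holds (IsPBounded.const 5) (IsPBounded.pow_holds hr 3))
    (IsPBounded.mul_holds (IsPBounded.const 6) (IsPBounded.pow_holds hr 2)))
    (IsPBounded.mul_holds (IsPBounded.const 2) hr)

/-- **The REPAIRED `LowDegreeRegime` — the finite-place twin, GRH-free (support for
stmt-ValiantsHypothesis-5391).** The item's statement with `FiniteDimensional ℚ K ∧` inserted
(closing the `finrank`-zero loophole): if `φ_n < 2^{t(n)}` is computed on the cube by fan-in-two
`ℂ`-circuits of p-bounded size whose constants, sum weights and output constant are algebraic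
integers in a number field `K_n ⊂ ℂ` of degree `≤ r(n)` (p-bounded), then the bits of `φ_n` have
polynomial-size `B₂`-circuits. Bertrand prime `p ∈ (2^t, 2^{t+1}]`, reduction
`exists_zmod_circuit_of_integral_constants`, Boolean simulation `cktSize_testBits_of_zmod`.
[cite: Burgisser2000TCS, §4–§5] -/
theorem lowDegreeRegime_of_finiteDimensional :
    ∀ (φ : ∀ n, (Fin n → Bool) → ℕ) (t : ℕ → ℕ), IsPBounded t → (∀ n x, φ n x < 2 ^ t n) →
      (∃ r : ℕ → ℕ, IsPBounded r ∧ ∀ n, ∃ (K : IntermediateField ℚ ℂ)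
        (P : ArithCircuit ℂ (Fin n)), FiniteDimensional ℚ K ∧ Module.finrank ℚ K ≤ r n ∧
          P.size ≤ r n ∧ P.IsFanInTwo ∧
          (∀ g ∈ P.gates, ∀ u ∈ Gate.args g, ∀ a : ℂ, u = Operand.const a →
            a ∈ K ∧ IsIntegral ℤ a) ∧
          (∀ args, Gate.sum args ∈ P.gates → ∀ a ∈ args, a.1 ∈ K ∧ IsIntegral ℤ a.1) ∧
          (∀ a : ℂ, P.output = Operand.const a → a ∈ K ∧ IsIntegral ℤ a) ∧
          ∀ x : Fin n → Bool, eval (boolPoint ℂ x) P.eval = (φ n x : ℂ)) →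
      ∃ q : Polynomial ℕ, ∀ n,
        CktSize B2 (fun (x : Fin n → Bool) (i : Fin (t n)) => (φ n x).testBit i) (q.eval n) := by
  intro φ t ht hφ ⟨r, hr, hP⟩
  obtain ⟨q, hq⟩ := (isPBounded_iff_exists_polynomial_holds _).1 (isPBounded_lowDegreeSize hr ht)
  refine ⟨q, fun n => ?_⟩
  obtain ⟨K, P, hKfd, hKr, hPs, hP2, hc, hw, ho, hval⟩ := hP n
  haveI := hKfd
  -- a Bertrand prime above `2^{t n}`
  obtain ⟨p, hp, hTp, hp2⟩ := Nat.exists_prime_lt_and_le_two_mul (2 ^ t n) (by positivity)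
  haveI : Fact p.Prime := ⟨hp⟩
  set ℓ := t n + 1 with hℓ
  have hpℓ : p ≤ 2 ^ ℓ := by rw [hℓ, pow_succ, mul_comm]; exact hp2
  -- the circuit modulo `p` and its Boolean simulation
  obtain ⟨Q, hQ2, hQs, hQv⟩ :=
    exists_zmod_circuit_of_integral_constants K P hP2 hc hw ho (φ n) hval p
  have hsim := cktSize_testBits_of_zmod hpℓ Q hQ2
  have hvalp : ∀ x, (eval (boolPoint (ZMod p) x) Q.eval).val = φ n x := by
    intro x
    rw [hQv x, ZMod.val_natCast_of_lt ((hφ n x).trans hTp)]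
  have hTℓ : t n ≤ ℓ := by omega
  refine ((hsim.outMap fun i : Fin (t n) => (⟨i, lt_of_lt_of_le i.2 hTℓ⟩ : Fin ℓ)).congr
    fun x i => ?_).of_le ?_
  · simp [hvalp]
  · refine le_trans ?_ (hq n)
    have hD : Module.finrank ℚ K ≤ r n := hKr
    have h1 : Q.size + 1 ≤ (5 * r n ^ 3 + 6 * r n ^ 2 + 2 * r n) * (3 * r n) + 3 * r n + 1 := by
      have := hQs
      have h3 : 3 * P.size ≤ 3 * r n := Nat.mul_le_mul_left 3 hPs
      calc Q.size + 1 ≤ (5 * Module.finrank ℚ K ^ 3 + 6 * Module.finrank ℚ K ^ 2 +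
            2 * Module.finrank ℚ K) * (3 * P.size) + 3 * Module.finrank ℚ K + 1 := by omega
        _ ≤ (5 * r n ^ 3 + 6 * r n ^ 2 + 2 * r n) * (3 * r n) + 3 * r n + 1 := by gcongr
    exact Nat.mul_le_mul_right _ h1

end Summit.ValiantsHypothesis.ValiantsHypothesis.Theorems.NumTame

end
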